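import Summits.AtomisticToContinuum.Crystallization.Theorems.FrustratedLawDichotomyLinkIsoToolkit

/-!
# FrustratedLawDichotomy · crux `AperiodicFrustratedLawGap` (stmt-AtomisticToContinuum-27623) — CORNER PAIRING I: degree transfer across a
# shared bond, and «path-type corners pair crystal-wise» (the combinatorial half of P `CapForcing`) (decomp-a2c, prover hand 2, gen 9)

Setting of P (lens-5 g29 NODE §4): a site `i` with a `Pat`-classified link (`LinkIso θ Pat y i τ`), a link vertex `j = τ w` with its own
classified link (`LinkIso θ Pat' y (τ w) τ'`), and `w' : Pat'` with `τ' w' = i` (`exists_preimage_centre`).  By `image_contacts_eq_of_shared_bond`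
(p821506) the contacts `C'(w')` of `w'` in `Pat'` and the contacts `C(w)` of `w` in `Pat` index the SAME four sites.  Here:

§1 **Degree transfer.**  For `a : Pat`, `a' : Pat'` indexing the same site (`τ' a' = τ a`):
`τ '' (C(w) ∩ C(a)) = τ' '' (C'(w') ∩ C'(a'))` (both are `N(i) ∩ N(τ w) ∩ N(τ a)`), hence `#(C(w) ∩ C(a)) = #(C'(w') ∩ C'(a'))`: the
induced contact graphs on the two 4-sets are isomorphic under the correspondence — in particular the corner TYPE (cuboctahedral `3.4.3.4`:
a perfect matching; anticuboctahedral `3².4²`: a path plus an isolated vertex) is the same on both sides.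
§2 **Path-type corners pair crystal-wise** (abstract over the patterns): if in `Pat'` at every path-type corner the diagonal pairs of the
4-set are exactly the pairs with degree sum `1` (isolated vertex + an end) — hypothesis `hP'`, a finite pattern fact — then at a path-type
corner `w` of `Pat` a DIAGONAL pair `{a, b} ⊆ C(w)` with degree sum `1` corresponds to a DIAGONAL pair `{a', b'} ⊆ C'(w')`.  (At matching-type corners —
every fcc corner, the six `3.4.3.4` corners of hcp — the correspondence preserves the matching but NOT necessarily the diagonals: that
is the twisted case, excluded only metrically; lens-5 NODE §4.)
§3 The integer facts by `decide`: in `fccInt` every contact pair has exactly ONE common contact (all corners matching-type); in `hcpInt`, at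
a corner with a degree-`2` contact, `diagonal ⟺ degree sum = 1`.
`[folklore]`; def-free; no `sorry`.
-/

noncomputable section

namespace Summit.AtomisticToContinuum.Crystallization.Theorems.FrustratedLawDichotomyCornerPairing

open Literature.Geometry.DiscreteGeometry
open Summit.AtomisticToContinuum.Crystallization.Theorems.FrustratedLawDichotomyTwoShellRigidityCut (E3 LinkIso)
open Summit.AtomisticToContinuum.Crystallization.Theorems.FrustratedLawDichotomyLinkIsoToolkit
  (commonNeighbors_eq_image image_contacts_eq_of_shared_bond)

variable {θ : ℝ} {Pat Pat' : Finset E3} {N : ℕ} {y : Fin N → E3} {i : Fin N} {τ : ↥Pat → Fin N} {τ' : ↥Pat' → Fin N}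

/-! ### §1 Degree transfer across a shared bond -/

/-- **The common contacts of `w` and `a` index the same sites as those of `w'` and `a'`** whenever `τ' w' = i` and `τ' a' = τ a`:
`τ '' (C(w) ∩ C(a)) = τ' '' (C'(w') ∩ C'(a'))` (both equal `N(i) ∩ N(τ w) ∩ N(τ a)`). [folklore] -/
theorem image_common_contacts_eq_of_shared_bond (hτ : Function.Injective τ) (hτ' : Function.Injective τ')
    (hL : LinkIso θ Pat y i τ) (w : ↥Pat) (hL' : LinkIso θ Pat' y (τ w) τ') {w' : ↥Pat'} (hw' : τ' w' = i)
    {a : ↥Pat} {a' : ↥Pat'} (ha : τ' a' = τ a) :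
    τ '' ({c : ↥Pat | dist (w : E3) (c : E3) = 1} ∩ {c : ↥Pat | dist (a : E3) (c : E3) = 1}) =
      τ' '' ({c' : ↥Pat' | dist (w' : E3) (c' : E3) = 1} ∩ {c' : ↥Pat' | dist (a' : E3) (c' : E3) = 1}) := by
  rw [Set.image_inter hτ, Set.image_inter hτ', ← commonNeighbors_eq_image hL w, ← commonNeighbors_eq_image hL a,
    ← commonNeighbors_eq_image hL' w', ← commonNeighbors_eq_image hL' a', hw', ha]
  ext k
  simp only [Set.mem_inter_iff]
  tauto

/-- **Degree transfer**: `#(C(w) ∩ C(a)) = #(C'(w') ∩ C'(a'))` — the number of contacts of `a` inside the corner 4-set `C(w)` equals that of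
`a'` inside `C'(w')`. [folklore] -/
theorem ncard_common_contacts_eq_of_shared_bond (hτ : Function.Injective τ) (hτ' : Function.Injective τ')
    (hL : LinkIso θ Pat y i τ) (w : ↥Pat) (hL' : LinkIso θ Pat' y (τ w) τ') {w' : ↥Pat'} (hw' : τ' w' = i)
    {a : ↥Pat} {a' : ↥Pat'} (ha : τ' a' = τ a) :
    ({c : ↥Pat | dist (w : E3) (c : E3) = 1} ∩ {c : ↥Pat | dist (a : E3) (c : E3) = 1}).ncard =
      ({c' : ↥Pat' | dist (w' : E3) (c' : E3) = 1} ∩ {c' : ↥Pat' | dist (a' : E3) (c' : E3) = 1}).ncard := by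
  rw [← Set.ncard_image_of_injective _ hτ, image_common_contacts_eq_of_shared_bond hτ hτ' hL w hL' hw' ha,
    Set.ncard_image_of_injective _ hτ']

/-- **Every contact of `w` has a unique partner among the contacts of `w'`** (indexing the same site). [folklore] -/
theorem exists_partner (hτ' : Function.Injective τ') (hL : LinkIso θ Pat y i τ) (w : ↥Pat)
    (hL' : LinkIso θ Pat' y (τ w) τ') {w' : ↥Pat'} (hw' : τ' w' = i) {a : ↥Pat} (ha : dist (w : E3) (a : E3) = 1) :
    ∃ a' : ↥Pat', dist (w' : E3) (a' : E3) = 1 ∧ τ' a' = τ a ∧ ∀ a'' : ↥Pat', τ' a'' = τ a → a'' = a' := by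
  have hmem : τ a ∈ τ' '' {v' : ↥Pat' | dist (w' : E3) (v' : E3) = 1} := by
    rw [image_contacts_eq_of_shared_bond hL w hL' hw']
    exact ⟨a, ha, rfl⟩
  obtain ⟨a', ha', hτa⟩ := hmem
  exact ⟨a', ha', hτa, fun a'' h => hτ' (h.trans hτa.symm)⟩

/-- **Contacts are preserved by the correspondence**: for partners `a ↔ a'`, `c ↔ c'`, `dist a c = 1 ↔ dist a' c' = 1`. [folklore] -/
theorem dist_eq_one_iff_of_partners (hL : LinkIso θ Pat y i τ) (w : ↥Pat) (hL' : LinkIso θ Pat' y (τ w) τ')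
    {a c : ↥Pat} {a' c' : ↥Pat'} (ha : τ' a' = τ a) (hc : τ' c' = τ c) :
    dist (a : E3) (c : E3) = 1 ↔ dist (a' : E3) (c' : E3) = 1 := by
  rw [← hL.2.2 a c, ← hL'.2.2 a' c', ha, hc]

/-! ### §2 Path-type corners pair crystal-wise (abstract over the patterns) -/

/-- **At a path-type corner, a degree-sum-one pair corresponds to a diagonal pair of the neighbour's pattern.**
Hypothesis `hP'` is the finite pattern fact for `Pat'` («at a corner `w'` having a degree-2 contact, two distinct contacts `x', y'` of `w'`
are a diagonal pair iff their degrees inside `C'(w')` sum to `1`»); the corner `w` of `Pat` is path-type (`b ∈ C(w)` of degree `2`) and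
`a, b₂ ∈ C(w)` have degree sum `1`.  Conclusion: the partners `a', b₂'` are a DIAGONAL pair of `Pat'`. [folklore] -/
theorem diagonal_partners_of_pathType (hτ : Function.Injective τ) (hτ' : Function.Injective τ')
    (hL : LinkIso θ Pat y i τ) (w : ↥Pat) (hL' : LinkIso θ Pat' y (τ w) τ') {w' : ↥Pat'} (hw' : τ' w' = i)
    (hP' : ∀ v' : ↥Pat', (∃ b' : ↥Pat', dist (v' : E3) (b' : E3) = 1 ∧
        ({c' : ↥Pat' | dist (v' : E3) (c' : E3) = 1} ∩ {c' : ↥Pat' | dist (b' : E3) (c' : E3) = 1}).ncard = 2) →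
      ∀ x' y' : ↥Pat', dist (v' : E3) (x' : E3) = 1 → dist (v' : E3) (y' : E3) = 1 → x' ≠ y' →
        ({c' : ↥Pat' | dist (v' : E3) (c' : E3) = 1} ∩ {c' : ↥Pat' | dist (x' : E3) (c' : E3) = 1}).ncard +
          ({c' : ↥Pat' | dist (v' : E3) (c' : E3) = 1} ∩ {c' : ↥Pat' | dist (y' : E3) (c' : E3) = 1}).ncard = 1 →
        dist (x' : E3) (y' : E3) = Real.sqrt 2)
    {a b b₂ : ↥Pat} (ha : dist (w : E3) (a : E3) = 1) (hb : dist (w : E3) (b : E3) = 1) (hb₂ : dist (w : E3) (b₂ : E3) = 1)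
    (hab₂ : a ≠ b₂)
    (hdeg2 : ({c : ↥Pat | dist (w : E3) (c : E3) = 1} ∩ {c : ↥Pat | dist (b : E3) (c : E3) = 1}).ncard = 2)
    (hsum : ({c : ↥Pat | dist (w : E3) (c : E3) = 1} ∩ {c : ↥Pat | dist (a : E3) (c : E3) = 1}).ncard +
      ({c : ↥Pat | dist (w : E3) (c : E3) = 1} ∩ {c : ↥Pat | dist (b₂ : E3) (c : E3) = 1}).ncard = 1)
    {a' b₂' : ↥Pat'} (ha' : τ' a' = τ a) (hb₂' : τ' b₂' = τ b₂) :
    dist (a' : E3) (b₂' : E3) = Real.sqrt 2 := by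
  -- partners of a, b, b₂ inside C'(w')
  obtain ⟨a₁, ha₁w, ha₁, ha₁u⟩ := exists_partner hτ' hL w hL' hw' ha
  obtain ⟨b₁, hb₁w, hb₁, -⟩ := exists_partner hτ' hL w hL' hw' hb
  obtain ⟨c₁, hc₁w, hc₁, hc₁u⟩ := exists_partner hτ' hL w hL' hw' hb₂
  have hEa : a' = a₁ := ha₁u a' ha'
  have hEc : b₂' = c₁ := hc₁u b₂' hb₂'
  subst hEa hEc
  -- w' is path-type (the degree-2 contact transfers), the degree sum transfers
  refine hP' w' ⟨b₁, hb₁w, ?_⟩ a' b₂' ha₁w hc₁w ?_ ?_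
  · rw [← ncard_common_contacts_eq_of_shared_bond hτ hτ' hL w hL' hw' hb₁]; exact hdeg2
  · intro h
    apply hab₂
    apply hτ
    rw [← ha₁, ← hc₁, h]
  · rw [← ncard_common_contacts_eq_of_shared_bond hτ hτ' hL w hL' hw' ha₁,
      ← ncard_common_contacts_eq_of_shared_bond hτ hτ' hL w hL' hw' hc₁]
    exact hsum

/-! ### §3 The integer facts (by `decide`) -/

set_option maxRecDepth 8000

/-- fcc: a contact pair has exactly ONE common contact (every edge of the cuboctahedron lies in exactly one triangle) — all twelve
corners are matching-type (`3.4.3.4`). [folklore] -/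
theorem fccInt_card_common_contacts_of_contact : ∀ w ∈ fccInt, ∀ a ∈ fccInt, sqNormInt (w - a) = ((2 : ℕ) : ℤ) →
    (fccInt.filter (fun c => sqNormInt (w - c) = ((2 : ℕ) : ℤ) ∧ sqNormInt (a - c) = ((2 : ℕ) : ℤ))).card = 1 := by
  decide

/-- hcp: a contact pair has one or two common contacts, and at a corner `w` with a degree-`2` contact (a `3².4²` corner: path plus isolated
vertex) two distinct contacts `x, y` of `w` form a DIAGONAL pair iff their degrees inside `C(w)` sum to `1`. [folklore] -/
theorem hcpInt_diagonal_iff_degree_sum_one_of_pathType : ∀ w ∈ hcpInt,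
    (∃ b ∈ hcpInt, sqNormInt (w - b) = ((18 : ℕ) : ℤ) ∧ (hcpInt.filter (fun c => sqNormInt (w - c) = ((18 : ℕ) : ℤ) ∧ sqNormInt (b - c) = ((18 : ℕ) : ℤ))).card = 2) →
    ∀ x ∈ hcpInt, ∀ y' ∈ hcpInt, sqNormInt (w - x) = ((18 : ℕ) : ℤ) → sqNormInt (w - y') = ((18 : ℕ) : ℤ) → x ≠ y' →
      ((hcpInt.filter (fun c => sqNormInt (w - c) = ((18 : ℕ) : ℤ) ∧ sqNormInt (x - c) = ((18 : ℕ) : ℤ))).card +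
          (hcpInt.filter (fun c => sqNormInt (w - c) = ((18 : ℕ) : ℤ) ∧ sqNormInt (y' - c) = ((18 : ℕ) : ℤ))).card = 1 ↔
        sqNormInt (x - y') = 2 * ((18 : ℕ) : ℤ)) := by
  decide

/-- hcp: six corners are path-type (`3².4²`) and six are matching-type (`3.4.3.4`): a corner is path-type iff it has a degree-`2` contact,
iff it has a degree-`0` contact. [folklore] -/
theorem hcpInt_pathType_iff_isolated : ∀ w ∈ hcpInt,
    (∃ b ∈ hcpInt, sqNormInt (w - b) = ((18 : ℕ) : ℤ) ∧ (hcpInt.filter (fun c => sqNormInt (w - c) = ((18 : ℕ) : ℤ) ∧ sqNormInt (b - c) = ((18 : ℕ) : ℤ))).card = 2) ↔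
    (∃ d ∈ hcpInt, sqNormInt (w - d) = ((18 : ℕ) : ℤ) ∧ (hcpInt.filter (fun c => sqNormInt (w - c) = ((18 : ℕ) : ℤ) ∧ sqNormInt (d - c) = ((18 : ℕ) : ℤ))).card = 0) := by
  decide

/-! ### §4 Transport to the real patterns: `hP'` holds for hcp, and (vacuously) for fcc -/

open Summit.AtomisticToContinuum.Crystallization.Theorems.FrustratedLawDichotomyCappedRigidityCertPatterns
  (dist_eq_one_iff_sqNormInt dist_eq_sqrt_two_iff_sqNormInt)

/-- Transport of a common-contact count from the integer model to the scaled pattern. [folklore] -/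
theorem ncard_common_contacts_scaledPattern {S : Finset (Fin 3 → ℤ)} {N₀ : ℕ} (hN : N₀ ≠ 0)
    {v₀ z₀ : Fin 3 → ℤ} (u a : ↥(scaledPattern S N₀))
    (hv : ((Real.sqrt N₀)⁻¹ • intVec v₀ : E3) = u) (hz : ((Real.sqrt N₀)⁻¹ • intVec z₀ : E3) = a) :
    ({c : ↥(scaledPattern S N₀) | dist (u : E3) (c : E3) = 1} ∩
        {c : ↥(scaledPattern S N₀) | dist (a : E3) (c : E3) = 1}).ncard =
      (S.filter (fun w => sqNormInt (v₀ - w) = N₀ ∧ sqNormInt (z₀ - w) = N₀)).card := by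
  classical
  set f : (Fin 3 → ℤ) → E3 := fun z => (Real.sqrt N₀)⁻¹ • intVec z with hf
  have hfinj : Function.Injective f := scaledPattern_map_injective hN
  set T : Set ↥(scaledPattern S N₀) := {c | dist (u : E3) (c : E3) = 1} ∩ {c | dist (a : E3) (c : E3) = 1} with hT
  have h1 : T.ncard = (Subtype.val '' T).ncard := (Set.ncard_image_of_injective _ Subtype.val_injective).symm
  have h2 : Subtype.val '' T = f '' (↑(S.filter (fun w => sqNormInt (v₀ - w) = N₀ ∧ sqNormInt (z₀ - w) = N₀)) : Set (Fin 3 → ℤ)) := by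
    ext x
    simp only [hT, Set.mem_image, Set.mem_inter_iff, Set.mem_setOf_eq, Finset.coe_filter]
    constructor
    · rintro ⟨⟨x', hx'⟩, ⟨hd1, hd2⟩, rfl⟩
      have hx'' := hx'
      simp only [scaledPattern, Finset.mem_image] at hx''
      obtain ⟨z, hzS, rfl⟩ := hx''
      refine ⟨z, ⟨hzS, ?_, ?_⟩, rfl⟩
      · rw [← hv] at hd1; exact (dist_eq_one_iff_sqNormInt hN v₀ z).1 hd1
      · rw [← hz] at hd2; exact (dist_eq_one_iff_sqNormInt hN z₀ z).1 hd2
    · rintro ⟨z, ⟨hzS, hd1, hd2⟩, rfl⟩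
      have hzmem : f z ∈ scaledPattern S N₀ := by
        simp only [scaledPattern, Finset.mem_image]
        exact ⟨z, hzS, rfl⟩
      refine ⟨⟨f z, hzmem⟩, ⟨?_, ?_⟩, rfl⟩
      · show dist (u : E3) (f z) = 1
        rw [← hv]; exact (dist_eq_one_iff_sqNormInt hN v₀ z).2 hd1
      · show dist (a : E3) (f z) = 1
        rw [← hz]; exact (dist_eq_one_iff_sqNormInt hN z₀ z).2 hd2
  rw [h1, h2, Set.ncard_image_of_injective _ hfinj, Set.ncard_coe_finset]

/-- Every element of a scaled pattern comes from the integer model. [folklore] -/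
theorem exists_int_of_mem_scaledPattern {S : Finset (Fin 3 → ℤ)} {N₀ : ℕ} (u : ↥(scaledPattern S N₀)) :
    ∃ v₀ ∈ S, ((Real.sqrt N₀)⁻¹ • intVec v₀ : E3) = u := by
  have hu := u.2
  simp only [scaledPattern, Finset.mem_image] at hu
  exact hu

/-- **hcp satisfies `hP'`**: at a path-type corner of the hcp pattern, two distinct contacts with degree sum `1` are a diagonal pair. [folklore] -/
theorem hcp_diagonal_of_pathType : ∀ v' : ↥hcpKissingPattern, (∃ b' : ↥hcpKissingPattern, dist (v' : E3) (b' : E3) = 1 ∧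
      ({c' : ↥hcpKissingPattern | dist (v' : E3) (c' : E3) = 1} ∩ {c' : ↥hcpKissingPattern | dist (b' : E3) (c' : E3) = 1}).ncard = 2) →
    ∀ x' y' : ↥hcpKissingPattern, dist (v' : E3) (x' : E3) = 1 → dist (v' : E3) (y' : E3) = 1 → x' ≠ y' →
      ({c' : ↥hcpKissingPattern | dist (v' : E3) (c' : E3) = 1} ∩ {c' : ↥hcpKissingPattern | dist (x' : E3) (c' : E3) = 1}).ncard +
        ({c' : ↥hcpKissingPattern | dist (v' : E3) (c' : E3) = 1} ∩ {c' : ↥hcpKissingPattern | dist (y' : E3) (c' : E3) = 1}).ncard = 1 →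
      dist (x' : E3) (y' : E3) = Real.sqrt 2 := by
  have h18 : (18 : ℕ) ≠ 0 := by norm_num
  intro v' ⟨b', hb', hdeg⟩ x' y' hx' hy' hne hsum
  obtain ⟨v₀, hv₀, hv⟩ := exists_int_of_mem_scaledPattern v'
  obtain ⟨b₀, hb₀, hb⟩ := exists_int_of_mem_scaledPattern b'
  obtain ⟨x₀, hx₀, hx⟩ := exists_int_of_mem_scaledPattern x'
  obtain ⟨y₀, hy₀, hy⟩ := exists_int_of_mem_scaledPattern y'
  have hdeg' : (hcpInt.filter (fun w => sqNormInt (v₀ - w) = ((18 : ℕ) : ℤ) ∧ sqNormInt (b₀ - w) = ((18 : ℕ) : ℤ))).card = 2 := by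
    rw [← ncard_common_contacts_scaledPattern h18 v' b' hv hb]; exact hdeg
  have hsum' : (hcpInt.filter (fun w => sqNormInt (v₀ - w) = ((18 : ℕ) : ℤ) ∧ sqNormInt (x₀ - w) = ((18 : ℕ) : ℤ))).card +
      (hcpInt.filter (fun w => sqNormInt (v₀ - w) = ((18 : ℕ) : ℤ) ∧ sqNormInt (y₀ - w) = ((18 : ℕ) : ℤ))).card = 1 := by
    rw [← ncard_common_contacts_scaledPattern h18 v' x' hv hx, ← ncard_common_contacts_scaledPattern h18 v' y' hv hy]
    exact hsum
  have hvb : sqNormInt (v₀ - b₀) = ((18 : ℕ) : ℤ) := by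
    rw [← hv, ← hb] at hb'; exact (dist_eq_one_iff_sqNormInt h18 v₀ b₀).1 hb'
  have hvx : sqNormInt (v₀ - x₀) = ((18 : ℕ) : ℤ) := by
    rw [← hv, ← hx] at hx'; exact (dist_eq_one_iff_sqNormInt h18 v₀ x₀).1 hx'
  have hvy : sqNormInt (v₀ - y₀) = ((18 : ℕ) : ℤ) := by
    rw [← hv, ← hy] at hy'; exact (dist_eq_one_iff_sqNormInt h18 v₀ y₀).1 hy'
  have hxy : x₀ ≠ y₀ := by
    intro h
    apply hne
    apply Subtype.ext
    rw [← hx, ← hy, h]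
  have key := (hcpInt_diagonal_iff_degree_sum_one_of_pathType v₀ hv₀ ⟨b₀, hb₀, hvb, hdeg'⟩ x₀ hx₀ y₀ hy₀ hvx hvy hxy).1 hsum'
  rw [← hx, ← hy]
  exact (dist_eq_sqrt_two_iff_sqNormInt h18 x₀ y₀).2 (by simpa using key)

/-- **fcc has no path-type corner** (every contact pair has exactly one common contact). [folklore] -/
theorem fcc_not_pathType (v' : ↥fccKissingPattern) : ¬ ∃ b' : ↥fccKissingPattern, dist (v' : E3) (b' : E3) = 1 ∧
    ({c' : ↥fccKissingPattern | dist (v' : E3) (c' : E3) = 1} ∩ {c' : ↥fccKissingPattern | dist (b' : E3) (c' : E3) = 1}).ncard = 2 := by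
  rintro ⟨b', hb', hdeg⟩
  obtain ⟨v₀, hv₀, hv⟩ := exists_int_of_mem_scaledPattern v'
  obtain ⟨b₀, hb₀, hb⟩ := exists_int_of_mem_scaledPattern b'
  have hdeg' : (fccInt.filter (fun w => sqNormInt (v₀ - w) = ((2 : ℕ) : ℤ) ∧ sqNormInt (b₀ - w) = ((2 : ℕ) : ℤ))).card = 2 := by
    rw [← ncard_common_contacts_scaledPattern two_ne_zero v' b' hv hb]; exact hdeg
  have hvb : sqNormInt (v₀ - b₀) = ((2 : ℕ) : ℤ) := by
    rw [← hv, ← hb] at hb'; exact (dist_eq_one_iff_sqNormInt two_ne_zero v₀ b₀).1 hb'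
  have := fccInt_card_common_contacts_of_contact v₀ hv₀ b₀ hb₀ hvb
  omega

/-- **fcc satisfies `hP'` vacuously.** [folklore] -/
theorem fcc_diagonal_of_pathType : ∀ v' : ↥fccKissingPattern, (∃ b' : ↥fccKissingPattern, dist (v' : E3) (b' : E3) = 1 ∧
      ({c' : ↥fccKissingPattern | dist (v' : E3) (c' : E3) = 1} ∩ {c' : ↥fccKissingPattern | dist (b' : E3) (c' : E3) = 1}).ncard = 2) →
    ∀ x' y' : ↥fccKissingPattern, dist (v' : E3) (x' : E3) = 1 → dist (v' : E3) (y' : E3) = 1 → x' ≠ y' →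
      ({c' : ↥fccKissingPattern | dist (v' : E3) (c' : E3) = 1} ∩ {c' : ↥fccKissingPattern | dist (x' : E3) (c' : E3) = 1}).ncard +
        ({c' : ↥fccKissingPattern | dist (v' : E3) (c' : E3) = 1} ∩ {c' : ↥fccKissingPattern | dist (y' : E3) (c' : E3) = 1}).ncard = 1 →
      dist (x' : E3) (y' : E3) = Real.sqrt 2 :=
  fun v' h => absurd h (fcc_not_pathType v')

/-! ### §5 The corner lemma at the real patterns -/

/-- **Path-type corners pair crystal-wise, neighbour's link hcp-classified.** [folklore] -/
theorem diagonal_partners_of_pathType_hcp {τ' : ↥hcpKissingPattern → Fin N} (hτ : Function.Injective τ)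
    (hτ' : Function.Injective τ') (hL : LinkIso θ Pat y i τ) (w : ↥Pat) (hL' : LinkIso θ hcpKissingPattern y (τ w) τ')
    {w' : ↥hcpKissingPattern} (hw' : τ' w' = i)
    {a b b₂ : ↥Pat} (ha : dist (w : E3) (a : E3) = 1) (hb : dist (w : E3) (b : E3) = 1) (hb₂ : dist (w : E3) (b₂ : E3) = 1)
    (hab₂ : a ≠ b₂)
    (hdeg2 : ({c : ↥Pat | dist (w : E3) (c : E3) = 1} ∩ {c : ↥Pat | dist (b : E3) (c : E3) = 1}).ncard = 2)
    (hsum : ({c : ↥Pat | dist (w : E3) (c : E3) = 1} ∩ {c : ↥Pat | dist (a : E3) (c : E3) = 1}).ncard +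
      ({c : ↥Pat | dist (w : E3) (c : E3) = 1} ∩ {c : ↥Pat | dist (b₂ : E3) (c : E3) = 1}).ncard = 1)
    {a' b₂' : ↥hcpKissingPattern} (ha' : τ' a' = τ a) (hb₂' : τ' b₂' = τ b₂) :
    dist (a' : E3) (b₂' : E3) = Real.sqrt 2 :=
  diagonal_partners_of_pathType hτ hτ' hL w hL' hw' hcp_diagonal_of_pathType ha hb hb₂ hab₂ hdeg2 hsum ha' hb₂'

/-- **A path-type corner is never fcc-classified on the neighbour's side** (degree `2` does not occur in fcc): from the same data, `False`.
[folklore] -/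
theorem not_pathType_of_fcc_neighbour {τ' : ↥fccKissingPattern → Fin N} (hτ : Function.Injective τ)
    (hτ' : Function.Injective τ') (hL : LinkIso θ Pat y i τ) (w : ↥Pat) (hL' : LinkIso θ fccKissingPattern y (τ w) τ')
    {w' : ↥fccKissingPattern} (hw' : τ' w' = i) {b : ↥Pat} (hb : dist (w : E3) (b : E3) = 1)
    (hdeg2 : ({c : ↥Pat | dist (w : E3) (c : E3) = 1} ∩ {c : ↥Pat | dist (b : E3) (c : E3) = 1}).ncard = 2) : False := by
  obtain ⟨b₁, hb₁w, hb₁, -⟩ := exists_partner hτ' hL w hL' hw' hb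
  refine fcc_not_pathType w' ⟨b₁, hb₁w, ?_⟩
  rw [← ncard_common_contacts_eq_of_shared_bond hτ hτ' hL w hL' hw' hb₁]
  exact hdeg2

end Summit.AtomisticToContinuum.Crystallization.Theorems.FrustratedLawDichotomyCornerPairing

end
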